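import Summits.QuantumFields.YangMills.Theorems.BalabanUVNodesN15CurvedLocalCoefLettersOfReg335UN
import Summits.QuantumFields.YangMills.Theorems.BalabanUVNodesN15BackgroundMatrixByParts
import Summits.QuantumFields.YangMills.Theorems.BalabanUVNodesN15AdjointGaugeAction
import HarnessLib

/-!
# N15 = NE2, road (c) — PROGRAMME (PC), towards (PC-A″) «the THIRD sup-norm entry `G′(U)∇*_U` of [B9] (3.42) in per-cube gauges», VI: THE ADJOINT LETTERS OF THE CUBE FROM (3.35) —
# the QUOTIENTS of the first-order coefficients `∇a^±` (n15-c∕283′'s `r_D`) and the three coefficient rows of the adjoint gradient's covariant shape (`r_R`, `r_{∇R}`, `r_B`) at a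
# site, from the entry letters of the gauged transporters there; and those entry letters from lit-balaban r06's class `Reg335Cube` on a set, in ONE gauge together with dag-n15-w2's
# coefficient letters (dag-n15-c g27, n15-c∕285)

Cell `pub-ymgap`, seat `pub-ymgap-dag-n15-c` (generation g27; R134 (a), s1; HUMAN RULING D-0062).  `bears_on: R4∕N15 · K3⁸ SpineGivenEndpointR13SepCoPHV (stmt-QuantumFields-27366)`;
filed `--kind proof --supports stmt-QuantumFields-27366 --as helper` — COUNT-NEUTRAL.  Pointwise inequalities + one ∃ (a `Set.piecewise` gauge, no definition); 0 `def`, 0 `sorry`.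
Imports dag-n15-w2 `…CurvedLocalCoefLettersOfReg335UN` (`uN_localCoefLetters_of_gauge335`, the entry letters `uN_abs_coordMat_conj_sub_one_entry_le_op` ∕ `…_sub_conj_entry_le_op`,
through it `uN_opLetters_of_gauge335`), n15 `…BackgroundMatrixByParts` (`fgradMat`), `…AdjointGaugeAction` (`coordMat_mulLeftRight_mul`, `uN_siteGauge_transpose_eq`).  Nothing in the
tree is modified.

WHAT.  §1 (abstract transporters `S`, a gauge matrix field `W`, `T` with `W(y)T_ν(y)W(y+e_ν)ᵀ = S_ν(y)`): ★ `rowSum_fgradMat_tCoefA_inl_le_at` ∕ `…_inr_le_at` — `Σ_j|∇_μ a^±_μ(x)_{ij}|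
≤ |κ|q` from `|S_μ(x+e_μ) − S_μ(x)| ≤ η²q` resp. `|S_μ(x) − S_μ(x−e_μ)| ≤ η²q` entrywise; `conj_transpose_eq` (`W(x)T_ν(x−e_ν)ᵀW(x−e_ν)ᵀ = S_ν(x−e_ν)ᵀ`); ★ `rowSum_smul_conj_sub_one_le_at`
(`Σ_j|η⁻¹(S_ν(x−e_ν)ᵀ − 1)_{ij}| ≤ |κ|p`), ★ `rowSum_fgradMat_neg_conj_le_at` (`≤ |κ|ηq`), ★ `rowSum_neg_conj_shift_le_at` (`≤ 1 + |κ|ηp`) — the rows `r_B`, `r_{∇R}`, `r_R` of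
n15-c∕284's covariant shape `M_W D*_ν M_{Wᵀ} = M_{−R^W}∇⁻_ν + M_{η⁻¹(R^W − 1)}`.  §2 (`M_n(ℂ)`, (3.35) on a set `Q`): ★★★ `uN_adjointEntryLetters_of_gauge335` — at a site of the
TWO-step interior of `Q`, the four entry letters `|S_μ(x) − 1|, |S_μ(x−e_μ) − 1| ≤ ηP`, `|S_μ(x+e_μ) − S_μ(x)|, |S_μ(x) − S_μ(x−e_μ)| ≤ η²Q` of the gauged transporters
(`P = κ_e2√n√n(C∕ξ)e^{ηC∕ξ}`, `Q = κ_e2√n√n(C∕ξ²)e^{ηC∕ξ}`); ★★★ `uN_exists_gauge_adjointLetters_of_reg335Cube` — from `Reg335Cube τ U η Q ξ C` ONE gauge `w` unitary everywhere with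
dag-n15-w2's coefficient letters AND the four entry letters on the two-step interior; ★★ `uN_conj_coordMat_eq` (`W(y)T_ν(y)W(y+e_ν)ᵀ = S_ν(y)` for `W = coordMat e Ad_w`, `T = coordMat e Ad_U`).

HONEST FRAMING ∕ LIMITS.  Letters of the transporters of ONE bond field in ONE gauge on ONE set; nothing summed, no propagator; (3.35) p.396, (3.50)–(3.52) p.400, Cor. 3.6 p.408 cited
for SHAPES.  NE2⁺ NOT PRINTED, NOT proved; N15 of record untouched; K3⁸ OPEN; counts UNMOVED.  Restate-immune (no Theses import).
-/

set_option autoImplicit false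

noncomputable section
open scoped BigOperators Matrix
open Finset

namespace Summit.QuantumFields.YangMills.BalabanUVNodes.N15.CurvedSpecies

open Summit.QuantumFields.YangMills.BalabanUVNodes.N15.BackgroundLayer (tCoefA tCoefC tCoefA_inl tCoefA_inr fgradMat)

/-! ## §1 Pointwise: the quotient rows of `a^±` and the three rows of the adjoint gradient's covariant shape -/

section Pointwise

variable {X J κ : Type} [Fintype κ] [DecidableEq κ] (η : ℝ) (τ : J → X ≃ X) (S : J → X → Matrix κ κ ℝ)

/-- ★ **QUOTIENT OF THE FORWARD COEFFICIENT, AT A SITE**: `|(S_μ(x+e_μ) − S_μ(x))_{ij}| ≤ η²q` ⟹ `Σ_j |(∇^η_μ a⁺_μ)(x)_{ij}| ≤ |κ|q` (`a⁺_μ = η⁻¹(S_μ − 1)`, quotient of weight `η⁻¹`).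
[cite: Balaban1985BackgroundPropagators, (3.35) p.396, (3.51)–(3.52) p.400 (shapes)] -/
theorem rowSum_fgradMat_tCoefA_inl_le_at {q : ℝ} (hη : 0 < η) {μ : J} {x : X} (hS : ∀ i j, |(S μ (τ μ x) - S μ x) i j| ≤ η ^ 2 * q) (i : κ) :
    ∑ j, |fgradMat η⁻¹ (τ μ) (tCoefA η (gaugePair τ S) (Sum.inl μ)) x i j| ≤ Fintype.card κ * q := by
  have hent : ∀ j, fgradMat η⁻¹ (τ μ) (tCoefA η (gaugePair τ S) (Sum.inl μ)) x i j = η⁻¹ * η⁻¹ * (S μ (τ μ x) - S μ x) i j := fun j => by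
    simp only [fgradMat, tCoefA_inl, gaugePair_inl, Matrix.smul_apply, Matrix.sub_apply, smul_eq_mul]; ring
  have hi : 0 ≤ η⁻¹ * η⁻¹ := by positivity
  calc ∑ j, |fgradMat η⁻¹ (τ μ) (tCoefA η (gaugePair τ S) (Sum.inl μ)) x i j| = ∑ j, η⁻¹ * η⁻¹ * |(S μ (τ μ x) - S μ x) i j| :=
        Finset.sum_congr rfl fun j _ => by rw [hent, abs_mul, abs_of_nonneg hi]
    _ ≤ ∑ _j : κ, η⁻¹ * η⁻¹ * (η ^ 2 * q) := Finset.sum_le_sum fun j _ => mul_le_mul_of_nonneg_left (hS i j) hi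
    _ = Fintype.card κ * q := by rw [Finset.sum_const, Finset.card_univ, nsmul_eq_mul]; field_simp

/-- ★ **QUOTIENT OF THE BACKWARD COEFFICIENT, AT A SITE**: `|(S_μ(x) − S_μ(x−e_μ))_{ij}| ≤ η²q` ⟹ `Σ_j |(∇^η_μ a⁻_μ)(x)_{ij}| ≤ |κ|q` (`a⁻_μ(x) = η⁻¹(1 − S_μ(x−e_μ)ᵀ)`).
[cite: Balaban1985BackgroundPropagators, (3.35) p.396, (3.51)–(3.52) p.400 (shapes)] -/
theorem rowSum_fgradMat_tCoefA_inr_le_at {q : ℝ} (hη : 0 < η) {μ : J} {x : X} (hS : ∀ i j, |(S μ x - S μ ((τ μ).symm x)) i j| ≤ η ^ 2 * q) (i : κ) :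
    ∑ j, |fgradMat η⁻¹ (τ μ) (tCoefA η (gaugePair τ S) (Sum.inr μ)) x i j| ≤ Fintype.card κ * q := by
  have hent : ∀ j, fgradMat η⁻¹ (τ μ) (tCoefA η (gaugePair τ S) (Sum.inr μ)) x i j = -(η⁻¹ * η⁻¹ * (S μ x - S μ ((τ μ).symm x)) j i) := fun j => by
    simp only [fgradMat, tCoefA_inr, gaugePair_inr, Equiv.symm_apply_apply, Matrix.smul_apply, Matrix.sub_apply, Matrix.transpose_apply, smul_eq_mul]; ring
  have hi : 0 ≤ η⁻¹ * η⁻¹ := by positivity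
  calc ∑ j, |fgradMat η⁻¹ (τ μ) (tCoefA η (gaugePair τ S) (Sum.inr μ)) x i j| = ∑ j, η⁻¹ * η⁻¹ * |(S μ x - S μ ((τ μ).symm x)) j i| :=
        Finset.sum_congr rfl fun j _ => by rw [hent, abs_neg, abs_mul, abs_of_nonneg hi]
    _ ≤ ∑ _j : κ, η⁻¹ * η⁻¹ * (η ^ 2 * q) := Finset.sum_le_sum fun j _ => mul_le_mul_of_nonneg_left (hS j i) hi
    _ = Fintype.card κ * q := by rw [Finset.sum_const, Finset.card_univ, nsmul_eq_mul]; field_simp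

variable {W : X → Matrix κ κ ℝ} {T : J → X → Matrix κ κ ℝ}

omit [DecidableEq κ] in
/-- the conjugated transposed transporter of n15-c∕284's covariant shape IS the transposed gauged transporter at the backward bond: `W(x)T_ν(x−e_ν)ᵀW(x−e_ν)ᵀ = S_ν(x−e_ν)ᵀ`
when `W(y)T_ν(y)W(y+e_ν)ᵀ = S_ν(y)`. [folklore] -/
theorem conj_transpose_eq (hWS : ∀ ν y, W y * T ν y * (W (τ ν y))ᵀ = S ν y) (ν : J) (x : X) :
    W x * (T ν ((τ ν).symm x))ᵀ * (W ((τ ν).symm x))ᵀ = (S ν ((τ ν).symm x))ᵀ := by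
  rw [← hWS ν ((τ ν).symm x), Equiv.apply_symm_apply, Matrix.transpose_mul, Matrix.transpose_mul, Matrix.transpose_transpose, ← Matrix.mul_assoc]

/-- ★ **THE ROW `r_B`**: `Σ_j |η⁻¹(W(x)T_ν(x−e_ν)ᵀW(x−e_ν)ᵀ − 1)_{ij}| ≤ |κ|p` from `|(S_ν(x−e_ν) − 1)_{ij}| ≤ ηp`. [cite: Balaban1985BackgroundPropagators, (3.35) p.396, (3.50) p.400 (shapes)] -/
theorem rowSum_smul_conj_sub_one_le_at (hWS : ∀ ν y, W y * T ν y * (W (τ ν y))ᵀ = S ν y) {p : ℝ} (hη : 0 < η) {ν : J} {x : X}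
    (hS1 : ∀ i j, |(S ν ((τ ν).symm x) - 1) i j| ≤ η * p) (i : κ) :
    ∑ j, |(η⁻¹ • (W x * (T ν ((τ ν).symm x))ᵀ * (W ((τ ν).symm x))ᵀ - 1)) i j| ≤ Fintype.card κ * p := by
  have e1 : W x * (T ν ((τ ν).symm x))ᵀ * (W ((τ ν).symm x))ᵀ - 1 = (S ν ((τ ν).symm x) - 1)ᵀ := by
    rw [conj_transpose_eq τ S hWS, Matrix.transpose_sub, Matrix.transpose_one]
  rw [e1]
  simp only [Matrix.smul_apply, Matrix.transpose_apply, smul_eq_mul, abs_mul, abs_inv, abs_of_pos hη]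
  calc ∑ j, η⁻¹ * |(S ν ((τ ν).symm x) - 1) j i| ≤ ∑ _j : κ, η⁻¹ * (η * p) :=
        Finset.sum_le_sum fun j _ => mul_le_mul_of_nonneg_left (hS1 j i) (inv_nonneg.2 hη.le)
    _ = Fintype.card κ * p := by rw [Finset.sum_const, Finset.card_univ, nsmul_eq_mul, inv_mul_cancel_left₀ hη.ne']

omit [DecidableEq κ] in
/-- ★ **THE ROW `r_{∇R}`**: `Σ_j |∇^η_ν(−W·T_ν(·−e_ν)ᵀ·W(·−e_ν)ᵀ)(x)_{ij}| ≤ |κ|·ηq` from `|(S_ν(x) − S_ν(x−e_ν))_{ij}| ≤ η²q`. [cite: Balaban1985BackgroundPropagators, (3.35) p.396, (3.50) p.400 (shapes)] -/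
theorem rowSum_fgradMat_neg_conj_le_at (hWS : ∀ ν y, W y * T ν y * (W (τ ν y))ᵀ = S ν y) {q : ℝ} (hη : 0 < η) {ν : J} {x : X}
    (hS2 : ∀ i j, |(S ν x - S ν ((τ ν).symm x)) i j| ≤ η ^ 2 * q) (i : κ) :
    ∑ j, |fgradMat η⁻¹ (τ ν) (fun y => -(W y * (T ν ((τ ν).symm y))ᵀ * (W ((τ ν).symm y))ᵀ)) x i j| ≤ Fintype.card κ * (η * q) := by
  have hA : W (τ ν x) * (T ν x)ᵀ * (W x)ᵀ = (S ν x)ᵀ := by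
    rw [← hWS ν x, Matrix.transpose_mul, Matrix.transpose_mul, Matrix.transpose_transpose, ← Matrix.mul_assoc]
  have hB := conj_transpose_eq τ S hWS ν x
  have hent : ∀ j, fgradMat η⁻¹ (τ ν) (fun y => -(W y * (T ν ((τ ν).symm y))ᵀ * (W ((τ ν).symm y))ᵀ)) x i j = -(η⁻¹ * (S ν x - S ν ((τ ν).symm x)) j i) := fun j => by
    simp only [fgradMat, Equiv.symm_apply_apply, hA, hB, Matrix.smul_apply, Matrix.sub_apply, Matrix.neg_apply, Matrix.transpose_apply, smul_eq_mul]; ring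
  calc ∑ j, |fgradMat η⁻¹ (τ ν) (fun y => -(W y * (T ν ((τ ν).symm y))ᵀ * (W ((τ ν).symm y))ᵀ)) x i j| = ∑ j, η⁻¹ * |(S ν x - S ν ((τ ν).symm x)) j i| :=
        Finset.sum_congr rfl fun j _ => by rw [hent, abs_neg, abs_mul, abs_of_pos (inv_pos.2 hη)]
    _ ≤ ∑ _j : κ, η⁻¹ * (η ^ 2 * q) := Finset.sum_le_sum fun j _ => mul_le_mul_of_nonneg_left (hS2 j i) (inv_nonneg.2 hη.le)
    _ = Fintype.card κ * (η * q) := by rw [Finset.sum_const, Finset.card_univ, nsmul_eq_mul]; field_simp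

/-- ★ **THE ROW `r_R`**: `Σ_j |(−W·T_ν(·−e_ν)ᵀ·W(·−e_ν)ᵀ)(x+e_ν)_{ij}| ≤ 1 + |κ|·ηp` from `|(S_ν(x) − 1)_{ij}| ≤ ηp` (the transposed gauged transporter at `x`).
[cite: Balaban1985BackgroundPropagators, (3.35) p.396, (3.50) p.400 (shapes)] -/
theorem rowSum_neg_conj_shift_le_at (hWS : ∀ ν y, W y * T ν y * (W (τ ν y))ᵀ = S ν y) {p : ℝ} {ν : J} {x : X} (hS1 : ∀ i j, |(S ν x - 1) i j| ≤ η * p) (i : κ) :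
    ∑ j, |((fun y => -(W y * (T ν ((τ ν).symm y))ᵀ * (W ((τ ν).symm y))ᵀ)) ∘ ⇑(τ ν)) x i j| ≤ 1 + Fintype.card κ * (η * p) := by
  have hA : W (τ ν x) * (T ν x)ᵀ * (W x)ᵀ = (S ν x)ᵀ := by
    rw [← hWS ν x, Matrix.transpose_mul, Matrix.transpose_mul, Matrix.transpose_transpose, ← Matrix.mul_assoc]
  have hx : ((fun y => -(W y * (T ν ((τ ν).symm y))ᵀ * (W ((τ ν).symm y))ᵀ)) ∘ ⇑(τ ν)) x = -(S ν x)ᵀ := by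
    rw [Function.comp_apply, Equiv.symm_apply_apply, hA]
  rw [hx]
  have h1 : ∑ j, |(1 : Matrix κ κ ℝ) j i| = 1 := by
    rw [Finset.sum_eq_single i (fun j _ hj => by rw [Matrix.one_apply_ne hj, abs_zero]) (fun h => (h (Finset.mem_univ _)).elim), Matrix.one_apply_eq, abs_one]
  have h2 : ∑ j, |(S ν x - 1) j i| ≤ Fintype.card κ * (η * p) := by
    refine (Finset.sum_le_sum fun j _ => hS1 j i).trans ?_
    rw [Finset.sum_const, Finset.card_univ, nsmul_eq_mul]
  calc ∑ j, |(-(S ν x)ᵀ) i j| = ∑ j, |(1 : Matrix κ κ ℝ) j i + (S ν x - 1) j i| :=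
        Finset.sum_congr rfl fun j _ => by rw [Matrix.neg_apply, Matrix.transpose_apply, abs_neg, Matrix.sub_apply, add_sub_cancel]
    _ ≤ ∑ j, (|(1 : Matrix κ κ ℝ) j i| + |(S ν x - 1) j i|) := Finset.sum_le_sum fun j _ => abs_add_le _ _
    _ ≤ 1 + Fintype.card κ * (η * p) := by rw [Finset.sum_add_distrib, h1]; exact add_le_add le_rfl h2

end Pointwise

/-! ## §2 `M_n(ℂ)`, (3.35) on a set: the four entry letters of the gauged transporters on the two-step interior, in one gauge with the coefficient letters -/

section Local

open scoped Matrix.Norms.L2Operator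
open Literature.MathematicalPhysics.QuantumFieldTheory.Balaban1983to89
open Literature.MathematicalPhysics.QuantumFieldTheory.Balaban1983to89.B9Eq39Adjoint (covD fluct)
open Literature.MathematicalPhysics.QuantumFieldTheory.Balaban1983to89.B9Eq3117Current (gaugeTr)
open Literature.MathematicalPhysics.QuantumFieldTheory.Balaban1983to89.B9Eq335RegularityClasses (Reg335Cube)
open Summit.QuantumFields.YangMills.BalabanUVNodes.N15.MatrixSpecies (coordMat basisConst basisConst_nonneg)
open Literature.Barriers.QuantumFields (traceForm)

variable {n : Type} [Fintype n] [DecidableEq n] [Nonempty n] {κ : Type} [Fintype κ] [DecidableEq κ] (e : Matrix n n ℂ ≃L[ℝ] (κ → ℝ))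
variable {X J : Type} [Fintype J] (τ : J → X ≃ X) (U : J → X → (Matrix n n ℂ)ˣ)

omit [Nonempty n] [Fintype J] in
/-- ★★ `W(y)·T_ν(y)·W(y+e_ν)ᵀ = S_ν(y)` for `W = coordMat e Ad_w` (unitary `w`), `T_ν = coordMat e Ad_{U_ν}`, `S_ν = coordMat e Ad_{wU_νw(·+e_ν)ᴴ}` (n15-c∕265 `cvT_scGaugeU`, pointwise,
abstract carrier). [cite: Balaban1985BackgroundPropagators, (3.28) p.395, (3.31) p.395 (shape)] -/
theorem uN_conj_coordMat_eq (he : ∀ A B : Matrix n n ℂ, traceForm A B = e A ⬝ᵥ e B) {w : X → Matrix n n ℂ} (hw : ∀ y, (w y)ᴴ * w y = 1) (V : J → X → Matrix n n ℂ) (ν : J) (y : X) :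
    coordMat e (ContinuousLinearMap.mulLeftRight ℝ (Matrix n n ℂ) (w y) (w y)ᴴ) * coordMat e (ContinuousLinearMap.mulLeftRight ℝ (Matrix n n ℂ) (V ν y) (V ν y)ᴴ) *
        (coordMat e (ContinuousLinearMap.mulLeftRight ℝ (Matrix n n ℂ) (w (τ ν y)) (w (τ ν y))ᴴ))ᵀ =
      coordMat e (ContinuousLinearMap.mulLeftRight ℝ (Matrix n n ℂ) (w y * V ν y * (w (τ ν y))ᴴ) (w y * V ν y * (w (τ ν y))ᴴ)ᴴ) := by
  have hT : (coordMat e (ContinuousLinearMap.mulLeftRight ℝ (Matrix n n ℂ) (w (τ ν y)) (w (τ ν y))ᴴ))ᵀ = coordMat e (ContinuousLinearMap.mulLeftRight ℝ (Matrix n n ℂ) (w (τ ν y))ᴴ (w (τ ν y))) :=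
    uN_siteGauge_transpose_eq e w he hw (τ ν y)
  rw [hT, coordMat_mulLeftRight_mul, coordMat_mulLeftRight_mul, Matrix.conjTranspose_mul, Matrix.conjTranspose_mul, Matrix.conjTranspose_conjTranspose]

omit [Fintype J] in
/-- ★★★ **THE FOUR ENTRY LETTERS OF THE GAUGED TRANSPORTERS ON THE TWO-STEP INTERIOR** (the hypotheses and the gauge extension `w` of dag-n15-w2 `uN_localCoefLetters_of_gauge335`, plus
`x + 2e_μ ∈ Q`): with `S_μ(y) = coordMat e (Ad_{w(y)U_μ(y)w(y+e_μ)ᴴ})`, `P = κ_e2√n·√n(C∕ξ)e^{ηC∕ξ}`, `Q = κ_e2√n·√n(C∕ξ²)e^{ηC∕ξ}`: `|(S_μ(x) − 1)_{ij}| ≤ ηP`, `|(S_μ(x−e_μ) − 1)_{ij}| ≤ ηP`,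
`|(S_μ(x+e_μ) − S_μ(x))_{ij}| ≤ η²Q`, `|(S_μ(x) − S_μ(x−e_μ))_{ij}| ≤ η²Q`. [cite: Balaban1985BackgroundPropagators, (3.35) p.396, (3.50)–(3.52) p.400, Cor. 3.6 p.408] -/
theorem uN_adjointEntryLetters_of_gauge335 {η : ℝ} (hη : 0 < η)
    (hU : ∀ μ x, (U μ x : Matrix n n ℂ) ∈ Matrix.unitaryGroup n ℂ) {Q : Set X} {ξ C : ℝ} {u : X → (Matrix n n ℂ)ˣ} {A : J → X → Matrix n n ℂ}
    (hu1 : ∀ z ∈ Q, ‖(u z : Matrix n n ℂ)‖ ≤ 1 ∧ ‖(((u z)⁻¹ : (Matrix n n ℂ)ˣ) : Matrix n n ℂ)‖ ≤ 1) (hg : ∀ μ, ∀ z ∈ Q, gaugeTr τ u U μ z = fluct η A μ z)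
    (hA : ∀ μ, ∀ z ∈ Q, ‖A μ z‖ < C * ξ⁻¹) (hD : ∀ μ ν, ∀ z ∈ Q, ‖((η : ℂ)⁻¹) • covD τ (fun _ _ => (1 : (Matrix n n ℂ)ˣ)) μ (A ν) z‖ < C * (ξ ^ 2)⁻¹)
    {w : X → Matrix n n ℂ} (hw : ∀ y, (w y)ᴴ * w y = 1) (hwu : ∀ z ∈ Q, w z = (u z : Matrix n n ℂ)) {x : X} (hx : x ∈ Q) (hx1 : ∀ μ, τ μ x ∈ Q)
    (hx2 : ∀ μ, (τ μ).symm x ∈ Q) (hx11 : ∀ μ, τ μ (τ μ x) ∈ Q) :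
    (∀ μ i j, |(coordMat e (ContinuousLinearMap.mulLeftRight ℝ (Matrix n n ℂ) (w x * (U μ x : Matrix n n ℂ) * (w (τ μ x))ᴴ) (w x * (U μ x : Matrix n n ℂ) * (w (τ μ x))ᴴ)ᴴ) - 1) i j| ≤
        η * (@basisConst κ _ (Matrix n n ℂ) Matrix.frobeniusNormedAddCommGroup Matrix.frobeniusNormedSpace e * (2 * Real.sqrt (Fintype.card n)) * (Real.sqrt (Fintype.card n) * ((C / ξ) * Real.exp (η * (C / ξ)))))) ∧
    (∀ μ i j, |(coordMat e (ContinuousLinearMap.mulLeftRight ℝ (Matrix n n ℂ) (w ((τ μ).symm x) * (U μ ((τ μ).symm x) : Matrix n n ℂ) * (w (τ μ ((τ μ).symm x)))ᴴ)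
        (w ((τ μ).symm x) * (U μ ((τ μ).symm x) : Matrix n n ℂ) * (w (τ μ ((τ μ).symm x)))ᴴ)ᴴ) - 1) i j| ≤
        η * (@basisConst κ _ (Matrix n n ℂ) Matrix.frobeniusNormedAddCommGroup Matrix.frobeniusNormedSpace e * (2 * Real.sqrt (Fintype.card n)) * (Real.sqrt (Fintype.card n) * ((C / ξ) * Real.exp (η * (C / ξ)))))) ∧
    (∀ μ i j, |(coordMat e (ContinuousLinearMap.mulLeftRight ℝ (Matrix n n ℂ) (w (τ μ x) * (U μ (τ μ x) : Matrix n n ℂ) * (w (τ μ (τ μ x)))ᴴ) (w (τ μ x) * (U μ (τ μ x) : Matrix n n ℂ) * (w (τ μ (τ μ x)))ᴴ)ᴴ) -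
        coordMat e (ContinuousLinearMap.mulLeftRight ℝ (Matrix n n ℂ) (w x * (U μ x : Matrix n n ℂ) * (w (τ μ x))ᴴ) (w x * (U μ x : Matrix n n ℂ) * (w (τ μ x))ᴴ)ᴴ)) i j| ≤
        η ^ 2 * (@basisConst κ _ (Matrix n n ℂ) Matrix.frobeniusNormedAddCommGroup Matrix.frobeniusNormedSpace e * (2 * Real.sqrt (Fintype.card n)) * (Real.sqrt (Fintype.card n) * ((C / ξ ^ 2) * Real.exp (η * (C / ξ)))))) ∧
    (∀ μ i j, |(coordMat e (ContinuousLinearMap.mulLeftRight ℝ (Matrix n n ℂ) (w x * (U μ x : Matrix n n ℂ) * (w (τ μ x))ᴴ) (w x * (U μ x : Matrix n n ℂ) * (w (τ μ x))ᴴ)ᴴ) -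
        coordMat e (ContinuousLinearMap.mulLeftRight ℝ (Matrix n n ℂ) (w ((τ μ).symm x) * (U μ ((τ μ).symm x) : Matrix n n ℂ) * (w (τ μ ((τ μ).symm x)))ᴴ)
          (w ((τ μ).symm x) * (U μ ((τ μ).symm x) : Matrix n n ℂ) * (w (τ μ ((τ μ).symm x)))ᴴ)ᴴ)) i j| ≤
        η ^ 2 * (@basisConst κ _ (Matrix n n ℂ) Matrix.frobeniusNormedAddCommGroup Matrix.frobeniusNormedSpace e * (2 * Real.sqrt (Fintype.card n)) * (Real.sqrt (Fintype.card n) * ((C / ξ ^ 2) * Real.exp (η * (C / ξ)))))) := by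
  obtain ⟨huQ, h1, h2⟩ := uN_opLetters_of_gauge335 (T := τ) U (cube := Q) hη hu1 hg hA hD
  have hU' : ∀ μ y, ((U μ y : Matrix n n ℂ))ᴴ * (U μ y : Matrix n n ℂ) = 1 := fun μ y => Matrix.mem_unitaryGroup_iff'.mp (hU μ y)
  set V : J → X → Matrix n n ℂ := fun μ y => w y * (U μ y : Matrix n n ℂ) * (w (τ μ y))ᴴ with hV
  have hVu : ∀ μ y, (V μ y)ᴴ * V μ y = 1 := fun μ y => uN_gaugeTransformed_bond_unitary τ w (fun μ y => (U μ y : Matrix n n ℂ)) hw hU' μ y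
  have hVg : ∀ μ z, z ∈ Q → τ μ z ∈ Q → V μ z = (gaugeTr τ u U μ z : Matrix n n ℂ) := fun μ z hz hz' => by
    rw [hV]; dsimp only
    rw [hwu z hz, hwu (τ μ z) hz', uN_val_gaugeTr_eq (T := τ) U (huQ (τ μ z) hz')]
  set L₁ : ℝ := η * (C / ξ) * Real.exp (η * (C / ξ)) with hL₁
  set L₂ : ℝ := η ^ 2 * (C / ξ ^ 2) * Real.exp (η * (C / ξ)) with hL₂
  have hfirst : ∀ μ z, z ∈ Q → τ μ z ∈ Q → ‖V μ z - 1‖ ≤ L₁ := fun μ z hz hz' => by rw [hVg μ z hz hz']; exact h1 μ z hz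
  -- the two differences: forward (`x`, `x + e_μ`) on the two-step interior, backward (`x − e_μ`, `x`) on the one-step interior
  have hdiffF : ∀ μ, ‖V μ (τ μ x) - V μ x‖ ≤ L₂ := fun μ => by
    rw [hVg μ x hx (hx1 μ), hVg μ (τ μ x) (hx1 μ) (hx11 μ)]; exact h2 μ μ x hx (hx1 μ)
  have hdiffB : ∀ μ, ‖V μ x - V μ ((τ μ).symm x)‖ ≤ L₂ := fun μ => by
    have hy := hx2 μ
    have h := h2 μ μ ((τ μ).symm x) hy (by rwa [Equiv.apply_symm_apply])
    rw [Equiv.apply_symm_apply] at h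
    rwa [hVg μ x hx (hx1 μ), hVg μ ((τ μ).symm x) hy (by rwa [Equiv.apply_symm_apply])]
  set kk : ℝ := @basisConst κ _ (Matrix n n ℂ) Matrix.frobeniusNormedAddCommGroup Matrix.frobeniusNormedSpace e * (2 * Real.sqrt (Fintype.card n)) with hkk
  have hkk0 : 0 ≤ kk := mul_nonneg (@basisConst_nonneg κ _ (Matrix n n ℂ) Matrix.frobeniusNormedAddCommGroup Matrix.frobeniusNormedSpace e) (by positivity)
  have hsq : 0 ≤ Real.sqrt (Fintype.card n) := Real.sqrt_nonneg _
  have hE1 : ∀ μ z, z ∈ Q → τ μ z ∈ Q → ∀ i j, |(coordMat e (ContinuousLinearMap.mulLeftRight ℝ (Matrix n n ℂ) (V μ z) (V μ z)ᴴ) - 1) i j| ≤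
      η * (kk * (Real.sqrt (Fintype.card n) * ((C / ξ) * Real.exp (η * (C / ξ))))) := fun μ z hz hz' i j => by
    refine (uN_abs_coordMat_conj_sub_one_entry_le_op e (hVu μ z) i j).trans ?_
    calc kk * (Real.sqrt (Fintype.card n) * ‖V μ z - 1‖) ≤ kk * (Real.sqrt (Fintype.card n) * L₁) := by gcongr; exact hfirst μ z hz hz'
      _ = η * (kk * (Real.sqrt (Fintype.card n) * ((C / ξ) * Real.exp (η * (C / ξ))))) := by rw [hL₁]; ring
  have hE2 : ∀ μ (y y' : X), ‖V μ y' - V μ y‖ ≤ L₂ → ∀ i j, |(coordMat e (ContinuousLinearMap.mulLeftRight ℝ (Matrix n n ℂ) (V μ y') (V μ y')ᴴ) -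
      coordMat e (ContinuousLinearMap.mulLeftRight ℝ (Matrix n n ℂ) (V μ y) (V μ y)ᴴ)) i j| ≤ η ^ 2 * (kk * (Real.sqrt (Fintype.card n) * ((C / ξ ^ 2) * Real.exp (η * (C / ξ))))) :=
    fun μ y y' hyy i j => by
    refine (uN_abs_coordMat_conj_sub_conj_entry_le_op e (hVu μ y) (hVu μ y') i j).trans ?_
    calc kk * (Real.sqrt (Fintype.card n) * ‖V μ y' - V μ y‖) ≤ kk * (Real.sqrt (Fintype.card n) * L₂) := by gcongr
      _ = η ^ 2 * (kk * (Real.sqrt (Fintype.card n) * ((C / ξ ^ 2) * Real.exp (η * (C / ξ))))) := by rw [hL₂]; ring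
  exact ⟨fun μ => hE1 μ x hx (hx1 μ), fun μ => hE1 μ ((τ μ).symm x) (hx2 μ) (by rw [Equiv.apply_symm_apply]; exact hx), fun μ => hE2 μ x (τ μ x) (hdiffF μ),
    fun μ => hE2 μ ((τ μ).symm x) x (hdiffB μ)⟩

/-- ★★★ **ONE GAUGE FOR ALL THE CUBE's LETTERS FROM THE CLASS (3.35) BY NAME** (∃-form; the class's gauge on `Q`, `1` off `Q` — `Set.piecewise`, no definition): `U(n)`-valued `U` in
`Reg335Cube τ U η Q ξ C`, `η, ξ > 0`, `C ≥ 0` ⟹ a site field `w`, UNITARY EVERYWHERE, with dag-n15-w2's coefficient letters (`a^±`, `c`) on the one-step interior of `Q` AND §2's four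
entry letters on the two-step interior. [cite: Balaban1985BackgroundPropagators, (3.35) p.396, Cor. 3.6 p.408] -/
theorem uN_exists_gauge_adjointLetters_of_reg335Cube (he : ∀ A B : Matrix n n ℂ, traceForm A B = e A ⬝ᵥ e B) {η : ℝ} (hη : 0 < η)
    (hU : ∀ μ x, (U μ x : Matrix n n ℂ) ∈ Matrix.unitaryGroup n ℂ) {Q : Set X} {ξ C : ℝ} (hξ : 0 < ξ) (hC : 0 ≤ C) (h : Reg335Cube τ U η Q ξ C) :
    ∃ w : X → Matrix n n ℂ, (∀ y, (w y)ᴴ * w y = 1) ∧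
      ∀ x, x ∈ Q → (∀ μ, τ μ x ∈ Q) → (∀ μ, (τ μ).symm x ∈ Q) → (∀ μ, τ μ (τ μ x) ∈ Q) →
        (∀ j' i, ∑ j, |tCoefA η (gaugePair τ fun μ y => coordMat e (ContinuousLinearMap.mulLeftRight ℝ (Matrix n n ℂ) (w y * (U μ y : Matrix n n ℂ) * (w (τ μ y))ᴴ) (w y * (U μ y : Matrix n n ℂ) * (w (τ μ y))ᴴ)ᴴ)) j' x i j| ≤ Fintype.card κ * (@basisConst κ _ (Matrix n n ℂ) Matrix.frobeniusNormedAddCommGroup Matrix.frobeniusNormedSpace e * (2 * Real.sqrt (Fintype.card n)) * (Real.sqrt (Fintype.card n) * ((C / ξ) * Real.exp (η * (C / ξ)))))) ∧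
        (∀ i, ∑ j, |tCoefC η (gaugePair τ fun μ y => coordMat e (ContinuousLinearMap.mulLeftRight ℝ (Matrix n n ℂ) (w y * (U μ y : Matrix n n ℂ) * (w (τ μ y))ᴴ) (w y * (U μ y : Matrix n n ℂ) * (w (τ μ y))ᴴ)ᴴ)) x i j| ≤ Fintype.card κ * (Fintype.card J * (Fintype.card κ * (@basisConst κ _ (Matrix n n ℂ) Matrix.frobeniusNormedAddCommGroup Matrix.frobeniusNormedSpace e * (2 * Real.sqrt (Fintype.card n)) * (Real.sqrt (Fintype.card n) * ((C / ξ) * Real.exp (η * (C / ξ))))) ^ 2 + (@basisConst κ _ (Matrix n n ℂ) Matrix.frobeniusNormedAddCommGroup Matrix.frobeniusNormedSpace e * (2 * Real.sqrt (Fintype.card n)) * (Real.sqrt (Fintype.card n) * ((C / ξ ^ 2) * Real.exp (η * (C / ξ)))))))) ∧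
        (∀ μ i j, |(coordMat e (ContinuousLinearMap.mulLeftRight ℝ (Matrix n n ℂ) (w x * (U μ x : Matrix n n ℂ) * (w (τ μ x))ᴴ) (w x * (U μ x : Matrix n n ℂ) * (w (τ μ x))ᴴ)ᴴ) - 1) i j| ≤ η * (@basisConst κ _ (Matrix n n ℂ) Matrix.frobeniusNormedAddCommGroup Matrix.frobeniusNormedSpace e * (2 * Real.sqrt (Fintype.card n)) * (Real.sqrt (Fintype.card n) * ((C / ξ) * Real.exp (η * (C / ξ)))))) ∧
        (∀ μ i j, |(coordMat e (ContinuousLinearMap.mulLeftRight ℝ (Matrix n n ℂ) (w ((τ μ).symm x) * (U μ ((τ μ).symm x) : Matrix n n ℂ) * (w (τ μ ((τ μ).symm x)))ᴴ) (w ((τ μ).symm x) * (U μ ((τ μ).symm x) : Matrix n n ℂ) * (w (τ μ ((τ μ).symm x)))ᴴ)ᴴ) - 1) i j| ≤ η * (@basisConst κ _ (Matrix n n ℂ) Matrix.frobeniusNormedAddCommGroup Matrix.frobeniusNormedSpace e * (2 * Real.sqrt (Fintype.card n)) * (Real.sqrt (Fintype.card n) * ((C / ξ) * Real.exp (η * (C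 / ξ)))))) ∧
        (∀ μ i j, |(coordMat e (ContinuousLinearMap.mulLeftRight ℝ (Matrix n n ℂ) (w (τ μ x) * (U μ (τ μ x) : Matrix n n ℂ) * (w (τ μ (τ μ x)))ᴴ) (w (τ μ x) * (U μ (τ μ x) : Matrix n n ℂ) * (w (τ μ (τ μ x)))ᴴ)ᴴ) - coordMat e (ContinuousLinearMap.mulLeftRight ℝ (Matrix n n ℂ) (w x * (U μ x : Matrix n n ℂ) * (w (τ μ x))ᴴ) (w x * (U μ x : Matrix n n ℂ) * (w (τ μ x))ᴴ)ᴴ)) i j| ≤ η ^ 2 * (@basisConst κ _ (Matrix n n ℂ) Matrix.frobeniusNormedAddCommGroup Matrix.frobeniusNormedSpace e * (2 * Real.sqrt (Fintype.card n)) * (Real.sqrt (Fintype.card n) * ((C / ξ ^ 2) * Real.exp (η * (C / ξ)))))) ∧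
        (∀ μ i j, |(coordMat e (ContinuousLinearMap.mulLeftRight ℝ (Matrix n n ℂ) (w x * (U μ x : Matrix n n ℂ) * (w (τ μ x))ᴴ) (w x * (U μ x : Matrix n n ℂ) * (w (τ μ x))ᴴ)ᴴ) - coordMat e (ContinuousLinearMap.mulLeftRight ℝ (Matrix n n ℂ) (w ((τ μ).symm x) * (U μ ((τ μ).symm x) : Matrix n n ℂ) * (w (τ μ ((τ μ).symm x)))ᴴ) (w ((τ μ).symm x) * (U μ ((τ μ).symm x) : Matrix n n ℂ) * (w (τ μ ((τ μ).symm x)))ᴴ)ᴴ)) i j| ≤ η ^ 2 * (@basisConst κ _ (Matrix n n ℂ) Matrix.frobeniusNormedAddCommGroup Matrix.frobeniusNormedSpace e * (2 * Real.sqrt (Fintype.card n)) * (Real.sqrt (Fintype.card n) * ((C / ξ ^ 2) * Real.exp (η * (C / ξ)))))) := by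
  classical
  obtain ⟨u, A, hu1, hg, hA, hD⟩ := h
  have huQ : ∀ z ∈ Q, (u z : Matrix n n ℂ) ∈ Matrix.unitaryGroup n ℂ := fun z hz => uN_mem_unitaryGroup_of_norm_le_one (u z) (hu1 z hz).1 (hu1 z hz).2
  have hwU : ∀ y, (Q.piecewise (fun z => (u z : Matrix n n ℂ)) (fun _ => 1) y)ᴴ * Q.piecewise (fun z => (u z : Matrix n n ℂ)) (fun _ => 1) y = 1 := fun y => by
    by_cases hy : y ∈ Q
    · rw [Set.piecewise_eq_of_mem _ _ _ hy]; exact Matrix.mem_unitaryGroup_iff'.mp (huQ y hy)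
    · rw [Set.piecewise_eq_of_notMem _ _ _ hy, Matrix.conjTranspose_one, Matrix.mul_one]
  refine ⟨Q.piecewise (fun z => (u z : Matrix n n ℂ)) (fun _ => 1), hwU, fun x hx hx1 hx2 hx11 => ?_⟩
  obtain ⟨hAl, hCl⟩ := uN_localCoefLetters_of_gauge335 e τ U he hη hU hξ hC hu1 hg hA hD hwU (fun z hz => Set.piecewise_eq_of_mem _ _ _ hz) hx hx1 hx2
  obtain ⟨h1, h2, h3, h4⟩ := uN_adjointEntryLetters_of_gauge335 e τ U hη hU hu1 hg hA hD hwU (fun z hz => Set.piecewise_eq_of_mem _ _ _ hz) hx hx1 hx2 hx11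
  exact ⟨hAl, hCl, h1, h2, h3, h4⟩

end Local

end Summit.QuantumFields.YangMills.BalabanUVNodes.N15.CurvedSpecies

end
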